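import Mathlib
import Literature.AlgebraicGeometry.Resolution.CobordantChartCoefficients

/-!
# Flat coordinate slices and the plane cobordant chart `(x, y) ↦ (s(c₀ + y₀), s^N(c₁ + y₁))`

Folklore infrastructure for the local weighted resolution game (route
ResolutionOfSingularities/WeightedInvariant, crux `LocalWeightedDrop`, item
stmt-ResolutionOfSingularities-8899), written for the plane case of the line
`hasse-ridge-face-selection` (the face drop `stub_faceDropPlane`, file
`Summits/…/Theorems/WeightedInvariantLocalWeightedDropFaceDropPlane.lean`), in the vocabulary
of `Mathlib.RingTheory.MvPowerSeries.Substitution` and of `CobordantChartCoefficients`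
(`CobordantChart.chart w c`, `CobordantChart.coeff_subst_chart`):

* FLAT SLICES (`§1`, any number of variables, any commutative ring): the crux's slicing family
  `X i.succ ↦ 0`, `X j ↦ X (i.predAbove j)` from `R[[X₀, …, Xₙ]]` to `R[[X₀, …, X_{n-1}]]` is
  substitutable (`hasSubst_slice`) and its coefficients are read off directly:
  `coeff β (g|_{X_{i+1} = 0}) = coeff (β.mapDomain i.succ.succAbove) g` (`coeff_subst_slice`);
  for the plane slice `i = 0` of `k[[s, y₀, y₁]]` the transported exponent is
  `Finsupp.cons (β 0) (single 1 (β 1))` (`mapDomain_succAbove_one`, `coeff_subst_slice_zero`).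
* THE PLANE `(1, N)`-CHART (`§2`, `N ≥ 1`, field `k`; the weight of `(i, j)` is `i + N j`): the
  coefficient formula of `g(s(c₀ + y₀), s^N(c₁ + y₁))` as a finitely supported sum over the line
  `i + N j = b` (`coeff_cons_subst_chart_plane`), the exponents on the line `i + N j = N d`
  (`weight_eq_mul_iff`, `finsum_line_eq_sum`), the `s^{Nd}`-ROW as a finite sum over `m ≤ d`
  (`coeff_cons_mul_subst_chart_plane`), and the point `c₁ = 0`, where the coefficient of
  `s^{i + N j} y₁^{j}` is `g_{ij} c₀^{i}` (`coeff_cons_subst_chart_plane_of_eq_zero`).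
* BINARY FORMS THROUGH TAYLOR COEFFICIENTS (`§3`): the Taylor coefficients at `r` of
  `∑ b_m Y^m` (`taylor_coeff_sum_monomial`), and: a polynomial of degree `≤ d` whose Taylor
  coefficients of order `< d` at `r` vanish is `P_d (Y - r)^d`
  (`eq_C_mul_X_sub_C_pow_of_taylor_coeff_eq_zero`).

No definitions.  Deliberately NOT here: weights other than `(1, N)` in `§2` (the general
coefficient formula is `CobordantChart.coeff_subst_chart`).
-/

namespace Literature.AlgebraicGeometry.Resolution.CobordantChartPlaneSlice

/-! ### 1. Flat coordinate slices -/

variable {R : Type*} [CommRing R] {n : ℕ}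

/-- The flat-slice family `X i.succ ↦ 0`, `X j ↦ X (i.predAbove j)` (`j ≠ i.succ`) is
substitutable. [folklore] -/
theorem hasSubst_slice (i : Fin n) :
    MvPowerSeries.HasSubst (fun j : Fin (n + 1) => if j = i.succ then
      (0 : MvPowerSeries (Fin n) R) else MvPowerSeries.X (Fin.predAbove i j)) :=
  MvPowerSeries.hasSubst_of_constantCoeff_zero fun j => by
    split_ifs <;> simp [MvPowerSeries.constantCoeff_X]

/-- `i.predAbove ∘ i.succ.succAbove = id`. [folklore] -/
theorem predAbove_succ_succAbove (i : Fin n) (m : Fin n) :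
    i.predAbove (i.succ.succAbove m) = m := by
  apply Fin.succAbove_right_injective (p := i.succ)
  exact Fin.succ_succAbove_predAbove (Fin.succAbove_ne i.succ m)

/-- COEFFICIENTS OF THE FLAT SLICE.  Killing `X i.succ` and renumbering the remaining variables
of `g ∈ R[[X₀, …, Xₙ]]` along `i.predAbove` gives the series whose coefficient at `β` is the
coefficient of `g` at the exponent `β` transported along `i.succ.succAbove` (zero at `i.succ`).
[folklore] -/
theorem coeff_subst_slice (i : Fin n) (g : MvPowerSeries (Fin (n + 1)) R) (β : Fin n →₀ ℕ) :
    MvPowerSeries.coeff β (MvPowerSeries.subst (fun j : Fin (n + 1) => if j = i.succ then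
      (0 : MvPowerSeries (Fin n) R) else MvPowerSeries.X (Fin.predAbove i j)) g) =
      MvPowerSeries.coeff (Finsupp.mapDomain i.succ.succAbove β) g := by
  classical
  rw [MvPowerSeries.coeff_subst (hasSubst_slice i) g β,
    finsum_eq_single _ (Finsupp.mapDomain i.succ.succAbove β)]
  · -- the surviving term
    have h0 : Finsupp.mapDomain i.succ.succAbove β i.succ = 0 :=
      Finsupp.mapDomain_notin_range _ _ (by simp)
    rw [Finsupp.prod_congr (g2 := fun s m =>
      (MvPowerSeries.X (Fin.predAbove i s) : MvPowerSeries (Fin n) R) ^ m)]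
    · rw [← MvPowerSeries.monomial_mapDomain_apply_one, ← Finsupp.mapDomain_comp]
      have hid : (Fin.predAbove i ∘ i.succ.succAbove) = id := funext (predAbove_succ_succAbove i)
      rw [hid, Finsupp.mapDomain_id, MvPowerSeries.coeff_monomial_same, smul_eq_mul, mul_one]
    · intro s hs
      have hs' : s ≠ i.succ := by
        rintro rfl
        exact (Finsupp.mem_support_iff.mp hs) h0
      simp [hs']
  · intro d hd
    by_cases hdi : d i.succ = 0
    · rw [Finsupp.prod_congr (g2 := fun s m =>
        (MvPowerSeries.X (Fin.predAbove i s) : MvPowerSeries (Fin n) R) ^ m)]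
      · rw [← MvPowerSeries.monomial_mapDomain_apply_one, MvPowerSeries.coeff_monomial, if_neg,
          smul_zero]
        intro hβ
        apply hd
        rw [hβ, ← Finsupp.mapDomain_comp]
        rw [Finsupp.mapDomain_congr (g := id), Finsupp.mapDomain_id]
        intro s hs
        have hs' : s ≠ i.succ := by
          rintro rfl
          exact (Finsupp.mem_support_iff.mp hs) hdi
        simp [Fin.succ_succAbove_predAbove hs']
      · intro s hs
        have hs' : s ≠ i.succ := by
          rintro rfl
          exact (Finsupp.mem_support_iff.mp hs) hdi
        simp [hs']
    · rw [Finsupp.prod, Finset.prod_eq_zero (Finsupp.mem_support_iff.mpr hdi), map_zero,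
        smul_zero]
      simp [zero_pow hdi]

/-- The exponent of the plane slice `i = 0` of `k[[s, y₀, y₁]]`: transporting `(r, j)` along
`(1 : Fin 3).succAbove` gives `(r, 0, j) = Finsupp.cons r (single 1 j)` (so, with
`coeff_subst_slice`, `coeff (r, j) G|_{y₀ = 0} = coeff (cons r (single 1 j)) G`). [folklore] -/
theorem mapDomain_succAbove_one (β : Fin 2 →₀ ℕ) :
    Finsupp.mapDomain (Fin.succ (0 : Fin 2)).succAbove β =
      Finsupp.cons (β 0) (Finsupp.single 1 (β 1)) := by
  have hβ : β = Finsupp.single 0 (β 0) + Finsupp.single 1 (β 1) := by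
    ext i; fin_cases i <;> simp
  conv_lhs => rw [hβ]
  rw [Finsupp.mapDomain_add, Finsupp.mapDomain_single, Finsupp.mapDomain_single]
  ext j
  refine Fin.cases ?_ (fun l => ?_) j
  · simp
  · rw [Finsupp.cons_succ]
    fin_cases l <;> simp

/-- The plane slice `i = 0` of `G ∈ R[[s, y₀, y₁]]` in coordinates:
`coeff (r, j) G|_{y₀ = 0} = coeff (cons r (single 1 j)) G`. [folklore] -/
theorem coeff_subst_slice_zero (G : MvPowerSeries (Fin 3) R) (β : Fin 2 →₀ ℕ) :
    MvPowerSeries.coeff β (MvPowerSeries.subst (fun j : Fin 3 => if j = (0 : Fin 2).succ then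
      (0 : MvPowerSeries (Fin 2) R) else MvPowerSeries.X (Fin.predAbove (0 : Fin 2) j)) G) =
      MvPowerSeries.coeff (Finsupp.cons (β 0) (Finsupp.single 1 (β 1))) G := by
  rw [← mapDomain_succAbove_one]
  exact coeff_subst_slice (0 : Fin 2) G β

/-! ### 2. The plane `(1, N)`-chart -/

open Literature.AlgebraicGeometry.Resolution

variable {k : Type*} [Field k]

/-- For `N ≥ 1` the weights `(1, N)` have no zero entry, so the crux convention
`wᵢ = 0 → cᵢ = 0` is vacuous. [folklore] -/
theorem one_cons_convention {N : ℕ} (hN : 1 ≤ N) (c : Fin 2 → k) :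
    ∀ i : Fin 2, (![1, N] : Fin 2 → ℕ) i = 0 → c i = 0 := by
  intro i hi
  fin_cases i
  · simp at hi
  · simp at hi; omega

/-- COEFFICIENT FORMULA of the plane chart `x ↦ s (c₀ + y₀)`, `y ↦ s^N (c₁ + y₁)`:
`coeff (b, β) g(chart) = ∑_{i + N j = b} g_{ij} · C(i, β₀) c₀^{i-β₀} · C(j, β₁) c₁^{j-β₁}`.
[folklore] -/
theorem coeff_cons_subst_chart_plane {N : ℕ} (hN : 1 ≤ N) (c : Fin 2 → k)
    (g : MvPowerSeries (Fin 2) k) (b : ℕ) (β : Fin 2 →₀ ℕ) :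
    MvPowerSeries.coeff (Finsupp.cons b β)
        (MvPowerSeries.subst (CobordantChart.chart ![1, N] c) g) =
      ∑ᶠ e : Fin 2 →₀ ℕ, if e 0 + N * e 1 = b then MvPowerSeries.coeff e g *
        ((((e 0).choose (β 0) : k) * c 0 ^ (e 0 - β 0)) *
          (((e 1).choose (β 1) : k) * c 1 ^ (e 1 - β 1))) else 0 := by
  rw [CobordantChart.coeff_subst_chart _ c (one_cons_convention hN c)]
  refine finsum_congr fun e => ?_
  -- the `(1, N)`-weight of `(i, j)` is `i + N j` (`ContactApprox.weight_one_cons`, Summits side)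
  have hw : Finsupp.weight ![1, N] e = e 0 + N * e 1 := by
    rw [Finsupp.weight_apply, Finsupp.sum_fintype _ _ (fun i => by simp)]
    simp [Fin.sum_univ_two, mul_comm]
  rw [hw, Fin.prod_univ_two]

/-- The exponents on the line `i + N j = N d` (`N ≥ 1`) are `(N (d - m), m)`, `m ≤ d`.
[folklore] -/
theorem weight_eq_mul_iff {N : ℕ} (hN : 1 ≤ N) (d : ℕ) (e : Fin 2 →₀ ℕ) :
    e 0 + N * e 1 = N * d ↔
      e 1 ≤ d ∧ e = Finsupp.single 0 (N * (d - e 1)) + Finsupp.single 1 (e 1) := by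
  constructor
  · intro h
    have h1 : e 1 ≤ d := by
      by_contra hlt
      have : N * (d + 1) ≤ N * e 1 := Nat.mul_le_mul_left N (by omega)
      nlinarith
    refine ⟨h1, ?_⟩
    have h0 : e 0 = N * (d - e 1) := by
      rw [Nat.mul_sub]
      omega
    ext i
    fin_cases i
    · simpa using h0
    · simp
  · rintro ⟨h1, he⟩
    have h0 : e 0 = N * (d - e 1) := by
      have := congrArg (fun f => f 0) he
      simpa using this
    rw [h0, Nat.mul_sub]
    have : N * e 1 ≤ N * d := Nat.mul_le_mul_left N h1
    omega

/-- A finitely supported sum over the line `i + N j = N d` is the finite sum over `m ≤ d` of the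
terms at `(N (d - m), m)`. [folklore] -/
theorem finsum_line_eq_sum {M : Type*} [AddCommMonoid M] {N : ℕ} (hN : 1 ≤ N) (d : ℕ)
    (F : (Fin 2 →₀ ℕ) → M) :
    ∑ᶠ e : Fin 2 →₀ ℕ, (if e 0 + N * e 1 = N * d then F e else 0) =
      ∑ m ∈ Finset.range (d + 1), F (Finsupp.single 0 (N * (d - m)) + Finsupp.single 1 m) := by
  classical
  have hinj : Set.InjOn
      (fun m : ℕ => Finsupp.single (0 : Fin 2) (N * (d - m)) + Finsupp.single 1 m)
      ↑(Finset.range (d + 1)) := by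
    intro m _ m' _ h
    have := congrArg (fun f => f 1) h
    simpa using this
  rw [finsum_eq_sum_of_support_subset _ (s := (Finset.range (d + 1)).image
      fun m => Finsupp.single (0 : Fin 2) (N * (d - m)) + Finsupp.single 1 m) ?_]
  · rw [Finset.sum_image hinj]
    refine Finset.sum_congr rfl fun m hm => ?_
    rw [if_pos]
    rw [weight_eq_mul_iff hN d]
    have hm' : m ≤ d := by simpa [Nat.lt_succ_iff] using hm
    simp [hm']
  · intro e he
    rw [Function.mem_support] at he
    have hw : e 0 + N * e 1 = N * d := by
      by_contra h
      exact he (if_neg h)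
    obtain ⟨h1, heq⟩ := (weight_eq_mul_iff hN d e).mp hw
    simp only [Finset.coe_image, Set.mem_image, Finset.mem_coe, Finset.mem_range]
    exact ⟨e 1, by omega, heq.symm⟩

/-- THE `s^{Nd}`-ROW OF THE PLANE CHART: for `N ≥ 1`,
`coeff (N d, β) g(chart) =
  ∑_{m ≤ d} g_{(N(d-m), m)} C(N(d-m), β₀) c₀^{N(d-m)-β₀} C(m, β₁) c₁^{m-β₁}`. [folklore] -/
theorem coeff_cons_mul_subst_chart_plane {N : ℕ} (hN : 1 ≤ N) (c : Fin 2 → k)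
    (g : MvPowerSeries (Fin 2) k) (d : ℕ) (β : Fin 2 →₀ ℕ) :
    MvPowerSeries.coeff (Finsupp.cons (N * d) β)
        (MvPowerSeries.subst (CobordantChart.chart ![1, N] c) g) =
      ∑ m ∈ Finset.range (d + 1),
        MvPowerSeries.coeff (Finsupp.single 0 (N * (d - m)) + Finsupp.single 1 m) g *
          ((((N * (d - m)).choose (β 0) : k) * c 0 ^ (N * (d - m) - β 0)) *
            ((m.choose (β 1) : k) * c 1 ^ (m - β 1))) := by
  rw [coeff_cons_subst_chart_plane hN, finsum_line_eq_sum hN d]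
  refine Finset.sum_congr rfl fun m _ => ?_
  simp

/-- The plane chart at a point with `c₁ = 0`: the coefficient of `s^{i + N j} y₁^{j}` in
`g(chart)` is `g_{ij} c₀^{i}` (only the exponent `(i, j)` itself contributes). [folklore] -/
theorem coeff_cons_subst_chart_plane_of_eq_zero {N : ℕ} (hN : 1 ≤ N) (c : Fin 2 → k)
    (hc : c 1 = 0) (g : MvPowerSeries (Fin 2) k) (e : Fin 2 →₀ ℕ) :
    MvPowerSeries.coeff (Finsupp.cons (e 0 + N * e 1) (Finsupp.single 1 (e 1)))
      (MvPowerSeries.subst (CobordantChart.chart ![1, N] c) g) =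
      MvPowerSeries.coeff e g * c 0 ^ (e 0) := by
  rw [coeff_cons_subst_chart_plane hN, finsum_eq_single _ e]
  · simp [hc]
  · intro e' he'
    split_ifs with hw
    · -- `e' ≠ e` on the same line: `e' 1 ≠ e 1`, and `C(e' 1, e 1) · 0^{e' 1 - e 1} = 0`
      have hne : e' 1 ≠ e 1 := by
        intro h1
        apply he'
        have h0 : e' 0 = e 0 := by rw [h1] at hw; omega
        ext i
        fin_cases i
        · exact h0
        · exact h1
      rcases lt_or_gt_of_ne hne with hlt | hgt
      · simp [Nat.choose_eq_zero_of_lt hlt]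
      · simp [hc, zero_pow (Nat.sub_ne_zero_of_lt hgt)]
    · rfl

/-! ### 3. Binary forms through Taylor coefficients -/

/-- TAYLOR COEFFICIENTS OF A SUM OF MONOMIALS at `r`:
`coeff_j (∑ b_m Y^m)(Y + r) = ∑ b_m r^{m-j} C(m, j)`. [folklore] -/
theorem taylor_coeff_sum_monomial (s : Finset ℕ) (b : ℕ → k) (r : k) (j : ℕ) :
    (Polynomial.taylor r (∑ m ∈ s, Polynomial.monomial m (b m))).coeff j =
      ∑ m ∈ s, b m * (r ^ (m - j) * (m.choose j : k)) := by
  rw [map_sum, Polynomial.finsetSum_coeff]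
  refine Finset.sum_congr rfl fun m _ => ?_
  rw [Polynomial.taylor_monomial, Polynomial.coeff_C_mul, Polynomial.coeff_X_add_C_pow]

/-- A polynomial of degree `≤ d` whose Taylor coefficients of order `< d` at `r` all vanish is
`P = P_d · (Y - r)^d`. [folklore] -/
theorem eq_C_mul_X_sub_C_pow_of_taylor_coeff_eq_zero (P : Polynomial k) (r : k) (d : ℕ)
    (hdeg : P.natDegree ≤ d) (h : ∀ j < d, (Polynomial.taylor r P).coeff j = 0) :
    P = Polynomial.C (P.coeff d) * (Polynomial.X - Polynomial.C r) ^ d := by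
  have hT : Polynomial.taylor r P = Polynomial.monomial d (P.coeff d) := by
    ext j
    rw [Polynomial.coeff_monomial]
    rcases lt_trichotomy j d with hj | rfl | hj
    · rw [h j hj, if_neg hj.ne']
    · rw [if_pos rfl]
      rcases hdeg.lt_or_eq with hlt | heq
      · rw [Polynomial.coeff_eq_zero_of_natDegree_lt hlt,
          Polynomial.coeff_eq_zero_of_natDegree_lt]
        rwa [Polynomial.natDegree_taylor]
      · rw [← heq, Polynomial.coeff_taylor_natDegree, Polynomial.leadingCoeff]
    · rw [if_neg hj.ne, Polynomial.coeff_eq_zero_of_natDegree_lt]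
      rw [Polynomial.natDegree_taylor]
      exact lt_of_le_of_lt hdeg hj
  conv_lhs => rw [← Polynomial.sum_taylor_eq P r, hT]
  rw [Polynomial.sum_monomial_index]
  simp

end Literature.AlgebraicGeometry.Resolution.CobordantChartPlaneSlice
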